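import Literature.AlgebraicGeometry.Resolution.ValuationRingOpenInNormalizationProofs
import HarnessLib

/-!
# A constant separating one extension of a valuation from its conjugates

Topic: `Literature/AlgebraicGeometry/Resolution` (valued fields). Groundwork for the
algebraization step of M. Temkin, *Inseparable local uniformization*, J. Algebra 373 (2013) =
arXiv:0804.1554v3, Thm. 3.3.1 (tree: `Temkin2013RelativeCurveSmoothFibre`): the `K`-side étale
chart of the common roof must see, on the finite constant field extension `m ⊇ k`, only the
valuation ring `m° = m ∩ L°` of the point (and the trivial one). This is arranged by inverting
ONE integral constant `μ ∈ Nr_m(k°)` which is a unit of `m°` and lies in the maximal ideal of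
every other extension of `k°` to `m` (weak approximation in the integral closure, Bourbaki,
*Alg. comm.* VI §7 no. 1 Prop. 2 Cor. 1 / §8 no. 6; in the tree through
`exists_forall_mem_lt_one_eq_one` and the finiteness `exists_finset_mem_iff_comap_eq` of
`ValuationRingOpenInNormalizationProofs.lean`).

* `exists_separating_unit` — for `l|k` finite, `O′` a valuation ring of `k` and `W` one of its
  extensions to `l`: an element `μ` lying in every valuation ring of `l` over `O′` (i.e. integral
  over `O′`), with `|μ|_W = 1` and `|μ|_{W′} < 1` for every other extension `W′` — PROVED;
* `mem_valuationSubring_of_isIntegral_of_forall_mem` — valuation rings are integrally closed —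
  PROVED;
* `eq_or_eq_top_of_valuation_eq_one` — consequently, if `O′` is maximal among the proper
  valuation rings of `k` (height one), every valuation ring `U ⊇ O′` of `l` in which `μ` is a
  unit is `W` or all of `l` — PROVED.

All statements are [folklore]; no definitions, no named facts.

## Sources

* N. Bourbaki, *Algèbre commutative* VI §7 no. 1 (Prop. 2, Cor. 1) and §8 no. 6 (Prop. 6),
  through the tree.
* M. Temkin, arXiv:0804.1554v3, proof of Thm. 3.3.1, Step 3 and Thm. 2.4.3 (iii) (the use).
-/

noncomputable section

namespace Literature.AlgebraicGeometry.Resolution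

universe u

variable {k : Type u} {l : Type u} [Field k] [Field l] [Algebra k l]

/-- **A separating integral unit.** For `l|k` finite, `O′` a valuation ring of `k` and `W` an
extension of `O′` to `l`, there is `μ ∈ l` lying in every valuation ring of `l` over `O′`, with
`|μ|_W = 1` and `|μ|_{W′} < 1` for every extension `W′ ≠ W` of `O′`. [folklore] -/
theorem exists_separating_unit [FiniteDimensional k l] (O' : ValuationSubring k)
    (W : ValuationSubring l) (hW : W.comap (algebraMap k l) = O') :
    ∃ μ : l, (∀ U : ValuationSubring l, O' ≤ U.comap (algebraMap k l) → μ ∈ U) ∧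
      W.valuation μ = 1 ∧
      ∀ W' : ValuationSubring l, W'.comap (algebraMap k l) = O' → W' ≠ W → W'.valuation μ < 1 := by
  classical
  obtain ⟨s, hs⟩ := exists_finset_mem_iff_comap_eq (l := l) O'
  have key : ∀ W' : {W' // W' ∈ s.erase W}, ∃ e : l,
      (∀ U : ValuationSubring l, O' ≤ U.comap (algebraMap k l) → e ∈ U) ∧
        W'.1.valuation e < 1 ∧ W.valuation e = 1 := fun W' =>
    exists_forall_mem_lt_one_eq_one ((hs W'.1).mp (Finset.mem_of_mem_erase W'.2)) hW
      (Finset.ne_of_mem_erase W'.2)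
  choose e he1 he2 he3 using key
  refine ⟨∏ W' ∈ (s.erase W).attach, e W', fun U hU => ?_, ?_, fun W' hW' hne => ?_⟩
  · exact prod_mem fun W' _ => he1 W' U hU
  · rw [map_prod]
    exact Finset.prod_eq_one fun W' _ => he3 W'
  · have hmem : W' ∈ s.erase W := Finset.mem_erase.mpr ⟨hne, (hs W').mpr hW'⟩
    have hle : ∀ W'' ∈ (s.erase W).attach, W'.valuation (e W'') ≤ 1 := fun W'' _ =>
      (W'.valuation_le_one_iff _).mpr (he1 W'' W' (le_of_eq hW'.symm))
    rw [map_prod, ← Finset.mul_prod_erase _ _ (Finset.mem_attach _ ⟨W', hmem⟩)]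
    calc W'.valuation (e ⟨W', hmem⟩) *
          ∏ W'' ∈ (s.erase W).attach.erase ⟨W', hmem⟩, W'.valuation (e W'')
        ≤ W'.valuation (e ⟨W', hmem⟩) * 1 :=
          mul_le_mul' le_rfl (Finset.prod_le_one' fun W'' hW'' =>
            hle W'' (Finset.mem_of_mem_erase hW''))
      _ < 1 := by rw [mul_one]; exact he2 ⟨W', hmem⟩

/-- Valuation rings are integrally closed: an element of `l` integral over `k`, all of which maps
into the valuation ring `U`, lies in `U`. [folklore] -/
theorem mem_valuationSubring_of_isIntegral_of_forall_mem (U : ValuationSubring l)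
    (hkU : ∀ c : k, algebraMap k l c ∈ U) {z : l} (hz : IsIntegral k z) : z ∈ U := by
  obtain ⟨f, hf, hfz⟩ := hz
  let ι : k →+* U :=
    { toFun := fun c => ⟨algebraMap k l c, hkU c⟩
      map_one' := Subtype.ext (by simp)
      map_mul' := fun _ _ => Subtype.ext (by simp)
      map_zero' := Subtype.ext (by simp)
      map_add' := fun _ _ => Subtype.ext (by simp) }
  obtain ⟨y, hy⟩ := IsIntegrallyClosed.algebraMap_eq_of_integral
    (⟨f.map ι, hf.map ι, by rw [Polynomial.eval₂_map]; exact hfz⟩ : IsIntegral U z)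
  exact hy ▸ y.2

/-- **Dichotomy for the valuation rings in which the separating constant is a unit.** If `O′`
is maximal among the proper valuation rings of `k` (height one), `l|k` is finite, `W` extends
`O′`, and `μ` is as in `exists_separating_unit`, then every valuation ring `U` of `l` containing
the image of `O′` with `|μ|_U = 1` equals `W` or is all of `l`. [folklore] -/
theorem eq_or_eq_top_of_valuation_eq_one [FiniteDimensional k l] {O' : ValuationSubring k}
    (hmax : ∀ S : ValuationSubring k, O' ≤ S → S = O' ∨ S = ⊤) {W : ValuationSubring l}
    {μ : l}
    (hμ : ∀ W' : ValuationSubring l, W'.comap (algebraMap k l) = O' → W' ≠ W → W'.valuation μ < 1)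
    (U : ValuationSubring l) (hU : O' ≤ U.comap (algebraMap k l)) (hUμ : U.valuation μ = 1) :
    U = W ∨ U = ⊤ := by
  rcases hmax _ hU with h | h
  · left
    by_contra hne
    have := hμ U h hne
    rw [hUμ] at this
    exact lt_irrefl _ this
  · right
    haveI : Algebra.IsIntegral k l := inferInstance
    have hkU : ∀ c : k, algebraMap k l c ∈ U := fun c => by
      have hc : c ∈ U.comap (algebraMap k l) := by rw [h]; exact ValuationSubring.mem_top c
      exact hc
    ext z
    exact ⟨fun _ => ValuationSubring.mem_top z, fun _ =>
      mem_valuationSubring_of_isIntegral_of_forall_mem U hkU (Algebra.IsIntegral.isIntegral z)⟩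

end Literature.AlgebraicGeometry.Resolution

end
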